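import Literature.NumberTheory.LFunctions.VinogradovKorobovDirichlet
import Literature.NumberTheory.LFunctions.TwistedRieszMean
import Literature.NumberTheory.LFunctions.PrimeNumberTheoremErrorTermProofs
import HarnessLib

/-!
# The twisted prime number theorem `∑_{n ≤ x} Λ(n)χ(n)n^{-iτ}` at a scale with a Vinogradov–Korobov region

Topic `Literature/NumberTheory/LFunctions`. Everything in this file is PROVED, from a Vinogradov–Korobov
zero-free region for Dirichlet `L`-functions in the inexplicit interface form `HasVKZeroFreeRegion c T₀`
(`c > 0`, any `T₀`; `VinogradovKorobovDirichlet.lean`) and the tree — theorems `…_of_vk` — with the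
specialisations to the named fact `Khale2024_zeroFreeRegion` (Khale, Q. J. Math. 75 (2024), Thm 1.1: the
explicit region, `HasVKZeroFreeRegion (1/61.5) 10`) under the original names.

* `TwistedVonMangoldt.twisted_sum_estimate_of_vk` / `twisted_sum_estimate` — assume a VK region
  `HasVKZeroFreeRegion c T₀`, `c > 0` (resp. Khale's theorem).  For `A > 0`, `θ > 2/3` and
  `K ≥ 0`: for all large `X`, every modulus `q ≤ (log X)^A`, every Dirichlet character `χ` mod `q`,
  every real `τ` with `|τ| ≤ X` and every `x` with `exp((log X)^θ)/2 ≤ x ≤ X`,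
  `‖∑_{n ≤ x} χ(n)Λ(n)n^{-iτ} − δ_χ x^{1−iτ}/(1 − iτ)‖ ≤ (log X)^{-K} x`, `δ_χ = 𝟙_{χ = χ₀}`.

This is the analytic heart of Matomäki–Radziwiłł's "Vinogradov–Korobov" bound for prime Dirichlet
polynomials `∑_{P ≤ p ≤ Q} p^{-1-it} ≪ log X/(1 + |t|) + (log X)^{-K}` on `exp((log X)^θ) ≤ P ≤ Q ≤ X`,
`|t| ≤ X` (MR, arXiv:1502.02374, Lemma 2) and of its character version, Lichtman 2020 Lemma 4.5
(`Literature.NumberTheory.Sieve.Lichtman2020_primeCharacterSum`, derived from the present theorem by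
partial summation in `MoebiusShiftedPrimesPrimeCharacterSum.lean`).

## The argument (Landau's method at a fixed scale)

With `b(n) = χ(n)Λ(n)n^{-iτ}` one has `∑ b(n)n^{-s} = −L'/L(s + iτ, χ)` (`σ > 1`), which is
`δ_χ/(s − a) + G(s)` with `a = 1 − iτ` and `G` holomorphic wherever `L(· + iτ, χ) ≠ 0` (for `χ = χ₀`,
`G = −L₁'/L₁(· + iτ)` with Mathlib's entire `L₁ = (s−1)L(s, χ₀)`).  By
`VKDirichlet.exists_norm_logDeriv_LFunction_le` / `…LFunctionTrivChar₁_le`, for `X` large `G` is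
holomorphic and `≪ (log X)³` on `[1 − (log X)^{-η}/2, 2] × [−T, T]` for any `T ≤ X` (`2/3 < η < θ`,
heights `|Im| ≤ T + |τ| ≤ 2X`), i.e. `TwistedRieszMean.TwistData` holds; the contour estimate
`TwistedRieszMean.TwistData.norm_rieszMean_sub_le` and the differencing step
`TwistedRieszMean.TwistData.norm_sum_sub_le` (with `y = x(1 + ε/4)`, `T ≍ (log X)^{O(1)}`, the
saving `x^{−(log X)^{-η}/2} ≤ exp(−(log X)^{θ−η}/2 + 1/2)` beating every power of `log X`, and the
de la Vallée-Poussin bound `ψ(y) − ψ(x) ≤ (y − x) + O(x e^{−c√log x})`,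
`ChebyshevPsiDeLaValleePoussin_holds`) give the claim.

## References

* K. Matomäki, M. Radziwiłł, *A note on the Liouville function in short intervals*,
  arXiv:1502.02374, Lemma 2. [MatomakiRadziwill2015]
* J. D. Lichtman, *Averages of the Möbius function on shifted primes*, arXiv:2009.08969, Lemma 4.5.
  [Lichtman2020]
* T. Khale, Q. J. Math. 75 (2024), 299–332, Theorem 1.1. [Khale2024]
* H. L. Montgomery, R. C. Vaughan, *Multiplicative Number Theory I*, §6.2. [MontgomeryVaughan2007]
-/

noncomputable section

open Complex Filter Topology Set Finset
open scoped ArithmeticFunction.vonMangoldt LSeries.notation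

namespace Literature.NumberTheory.LFunctions

namespace TwistedVonMangoldt

/-! ### Growth lemmas: powers of `log X` against exponentials of powers -/

/-- For `κ, μ > 0` and any `c, p`: `c L^p ≤ exp(κ L^μ)` for all large `L`. [folklore] -/
theorem eventually_mul_rpow_le_exp (c p : ℝ) {κ μ : ℝ} (hκ : 0 < κ) (hμ : 0 < μ) :
    ∀ᶠ ℓ : ℝ in atTop, c * ℓ ^ p ≤ Real.exp (κ * ℓ ^ μ) := by
  have hμ2 : 0 < μ / 2 := by positivity
  set c' : ℝ := |c| + 1 with hc'
  have hc'1 : 1 ≤ c' := by rw [hc']; have := abs_nonneg c; linarith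
  set M₀ : ℝ := (2 * |p| / μ + Real.log c') / κ + 1 with hM₀
  have hlogc' : 0 ≤ Real.log c' := Real.log_nonneg hc'1
  have hM₀pos : 0 < M₀ := by rw [hM₀]; positivity
  filter_upwards [eventually_ge_atTop (max 1 (M₀ ^ (2 / μ)))] with ℓ hL
  have hL1 : 1 ≤ ℓ := (le_max_left _ _).trans hL
  have hL0 : 0 < ℓ := by linarith
  have hLM : M₀ ^ (2 / μ) ≤ ℓ := (le_max_right _ _).trans hL
  -- `M₀ ≤ ℓ^{μ/2}`
  have hM : M₀ ≤ ℓ ^ (μ / 2) := by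
    have h := Real.rpow_le_rpow (Real.rpow_nonneg hM₀pos.le _) hLM hμ2.le
    rwa [← Real.rpow_mul hM₀pos.le, show 2 / μ * (μ / 2) = 1 by field_simp, Real.rpow_one] at h
  have hLμ1 : 1 ≤ ℓ ^ (μ / 2) := Real.one_le_rpow hL1 hμ2.le
  -- `c ℓ^p ≤ c' ℓ^{|p|} = exp(log c' + |p| log ℓ)`
  have h1 : c * ℓ ^ p ≤ c' * ℓ ^ |p| := by
    have hp : ℓ ^ p ≤ ℓ ^ |p| := Real.rpow_le_rpow_of_exponent_le hL1 (le_abs_self p)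
    calc c * ℓ ^ p ≤ |c| * ℓ ^ p := mul_le_mul_of_nonneg_right (le_abs_self c) (Real.rpow_nonneg hL0.le _)
      _ ≤ |c| * ℓ ^ |p| := mul_le_mul_of_nonneg_left hp (abs_nonneg c)
      _ ≤ c' * ℓ ^ |p| := mul_le_mul_of_nonneg_right (by rw [hc']; linarith) (Real.rpow_nonneg hL0.le _)
  have h2 : c' * ℓ ^ |p| = Real.exp (Real.log c' + |p| * Real.log ℓ) := by
    rw [Real.exp_add, Real.exp_log (by linarith), Real.rpow_def_of_pos hL0, mul_comm (Real.log ℓ)]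
  -- `log c' + |p| log ℓ ≤ κ ℓ^μ`
  have hlogL : Real.log ℓ ≤ ℓ ^ (μ / 2) / (μ / 2) := Real.log_le_rpow_div hL0.le hμ2
  have h3 : Real.log c' + |p| * Real.log ℓ ≤ κ * ℓ ^ μ := by
    have h4 : |p| * Real.log ℓ ≤ 2 * |p| / μ * ℓ ^ (μ / 2) := by
      calc |p| * Real.log ℓ ≤ |p| * (ℓ ^ (μ / 2) / (μ / 2)) :=
            mul_le_mul_of_nonneg_left hlogL (abs_nonneg p)
        _ = 2 * |p| / μ * ℓ ^ (μ / 2) := by field_simp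
    have h5 : Real.log c' ≤ Real.log c' * ℓ ^ (μ / 2) := le_mul_of_one_le_right hlogc' hLμ1
    have h6 : (2 * |p| / μ + Real.log c') ≤ κ * M₀ := by
      rw [hM₀, mul_add, mul_div_cancel₀ _ hκ.ne']; linarith
    have h7 : ℓ ^ μ = ℓ ^ (μ / 2) * ℓ ^ (μ / 2) := by
      rw [← Real.rpow_add hL0]; ring_nf
    calc Real.log c' + |p| * Real.log ℓ ≤ (2 * |p| / μ + Real.log c') * ℓ ^ (μ / 2) := by
          rw [add_mul]; linarith
      _ ≤ κ * M₀ * ℓ ^ (μ / 2) := mul_le_mul_of_nonneg_right h6 (by positivity)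
      _ ≤ κ * ℓ ^ (μ / 2) * ℓ ^ (μ / 2) := by gcongr
      _ = κ * ℓ ^ μ := by rw [h7]; ring
  calc c * ℓ ^ p ≤ c' * ℓ ^ |p| := h1
    _ = Real.exp (Real.log c' + |p| * Real.log ℓ) := h2
    _ ≤ Real.exp (κ * ℓ ^ μ) := Real.exp_le_exp.2 h3

/-- The same along `X → ∞` with `L = log X`. [folklore] -/
theorem eventually_mul_log_rpow_le_exp (c p : ℝ) {κ μ : ℝ} (hκ : 0 < κ) (hμ : 0 < μ) :
    ∀ᶠ X : ℝ in atTop, c * Real.log X ^ p ≤ Real.exp (κ * Real.log X ^ μ) :=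
  Real.tendsto_log_atTop.eventually (eventually_mul_rpow_le_exp c p hκ hμ)

/-! ### The twisted coefficients and their Dirichlet series -/

variable {q : ℕ} [NeZero q]

/-- The twisted von Mangoldt coefficients `b(n) = χ(n) Λ(n) n^{-iτ}`. [cite: Lichtman2020, Lemma 4.5 (proof)] -/
def twist (χ : DirichletCharacter ℂ q) (τ : ℝ) : ℕ → ℂ :=
  fun n ↦ χ n * (Λ n : ℂ) * (n : ℂ) ^ (-(τ * I))

omit [NeZero q] in
/-- `|b(n)| ≤ Λ(n)`. [folklore] -/
theorem norm_twist_le (χ : DirichletCharacter ℂ q) (τ : ℝ) (n : ℕ) : ‖twist χ τ n‖ ≤ Λ n := by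
  have hΛ : 0 ≤ Λ n := ArithmeticFunction.vonMangoldt_nonneg
  rcases eq_or_ne n 0 with rfl | hn
  · simp [twist]
  unfold twist
  rw [norm_mul, norm_mul, Complex.norm_natCast_cpow_of_pos (Nat.pos_of_ne_zero hn), Complex.norm_real,
    Real.norm_of_nonneg hΛ]
  simp only [neg_re, mul_re, ofReal_re, I_re, mul_zero, ofReal_im, I_im, mul_one, sub_self,
    neg_zero, Real.rpow_zero, mul_one]
  calc ‖χ n‖ * Λ n ≤ 1 * Λ n := by gcongr; exact DirichletCharacter.norm_le_one χ _
    _ = Λ n := one_mul _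

omit [NeZero q] in
/-- The terms: `b(n) n^{-s} = χ(n)Λ(n) n^{-(s + iτ)}`. [folklore] -/
theorem term_twist (χ : DirichletCharacter ℂ q) (τ : ℝ) (s : ℂ) (n : ℕ) :
    LSeries.term (twist χ τ) s n = LSeries.term (↗χ * ↗Λ) (s + τ * I) n := by
  rcases eq_or_ne n 0 with rfl | hn
  · simp [LSeries.term_zero]
  have hn0 : (n : ℂ) ≠ 0 := Nat.cast_ne_zero.2 hn
  rw [LSeries.term_of_ne_zero hn, LSeries.term_of_ne_zero hn, twist, Pi.mul_apply,
    Complex.cpow_add _ _ hn0, Complex.cpow_neg]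
  have h1 : (n : ℂ) ^ s ≠ 0 := by rw [Ne, Complex.cpow_eq_zero_iff]; exact fun h ↦ hn0 h.1
  have h2 : (n : ℂ) ^ ((τ : ℂ) * I) ≠ 0 := by
    rw [Ne, Complex.cpow_eq_zero_iff]; exact fun h ↦ hn0 h.1
  field_simp

omit [NeZero q] in
/-- `∑ b(n) n^{-s} = L(χΛ, s + iτ)`. [folklore] -/
theorem LSeries_twist (χ : DirichletCharacter ℂ q) (τ : ℝ) (s : ℂ) :
    LSeries (twist χ τ) s = L (↗χ * ↗Λ) (s + τ * I) := by
  simp only [LSeries, term_twist]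

/-- `δ_χ = 1` for the principal character and `0` otherwise. [folklore] -/
def delta (χ : DirichletCharacter ℂ q) : ℂ := if χ = 1 then 1 else 0

/-- `|δ_χ| ≤ 1`. [folklore] -/
theorem norm_delta_le (χ : DirichletCharacter ℂ q) : ‖delta χ‖ ≤ 1 := by
  unfold delta; split_ifs <;> simp

/-- The holomorphic part `G` of `∑ b(n)n^{-s} = δ_χ/(s − (1 − iτ)) + G(s)`:
`G(s) = −L₁'/L₁(s + iτ)` for `χ = χ₀` (`L₁ = (s−1)L(s, χ₀)`, Mathlib's `LFunctionTrivChar₁`), and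
`G(s) = −L'/L(s + iτ, χ)` otherwise. [cite: MontgomeryVaughan2007, §11.3 (11.22)] -/
def G (χ : DirichletCharacter ℂ q) (τ : ℝ) (s : ℂ) : ℂ :=
  if χ = 1 then -(deriv (DirichletCharacter.LFunctionTrivChar₁ q) (s + τ * I) /
      DirichletCharacter.LFunctionTrivChar₁ q (s + τ * I))
  else -(deriv χ.LFunction (s + τ * I) / χ.LFunction (s + τ * I))

/-- `G` for a non-principal character. [folklore] -/
theorem G_of_ne_one {χ : DirichletCharacter ℂ q} (hχ : χ ≠ 1) (τ : ℝ) :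
    G χ τ = fun s ↦ -(deriv χ.LFunction (s + τ * I) / χ.LFunction (s + τ * I)) := by
  funext s; simp [G, hχ]

/-- `G` for the principal character. [folklore] -/
theorem G_one (τ : ℝ) :
    G (1 : DirichletCharacter ℂ q) τ = fun s ↦
      -(deriv (DirichletCharacter.LFunctionTrivChar₁ q) (s + τ * I) /
        DirichletCharacter.LFunctionTrivChar₁ q (s + τ * I)) := by
  funext s; simp [G]

/-- **The principal character: `−L'/L(w, χ₀) = 1/(w − 1) − L₁'/L₁(w)`** for `Re w > 1`, where
`L₁(w) = (w − 1)L(w, χ₀)` is Mathlib's entire `LFunctionTrivChar₁` (`L₁' = (w−1)L' + L`).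
[cite: MontgomeryVaughan2007, §11.3 (11.22)] -/
theorem neg_logDeriv_LFunction_one_eq {w : ℂ} (hw : 1 < w.re) :
    -(deriv (1 : DirichletCharacter ℂ q).LFunction w / (1 : DirichletCharacter ℂ q).LFunction w) =
      1 / (w - 1) - deriv (DirichletCharacter.LFunctionTrivChar₁ q) w /
        DirichletCharacter.LFunctionTrivChar₁ q w := by
  have hw1 : w ≠ 1 := by rintro rfl; simp at hw
  have hL : (1 : DirichletCharacter ℂ q).LFunction w ≠ 0 :=
    DirichletCharacter.LFunction_ne_zero_of_one_le_re (1 : DirichletCharacter ℂ q) (Or.inr hw1) hw.le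
  have hL₁ : DirichletCharacter.LFunctionTrivChar₁ q w =
      (w - 1) * (1 : DirichletCharacter ℂ q).LFunction w := by
    rw [DirichletCharacter.LFunctionTrivChar₁, Function.update_of_ne hw1]
  have hd : deriv (DirichletCharacter.LFunctionTrivChar₁ q) w =
      (w - 1) * deriv (1 : DirichletCharacter ℂ q).LFunction w +
        (1 : DirichletCharacter ℂ q).LFunction w :=
    DirichletCharacter.deriv_LFunctionTrivChar₁_apply_of_ne_one q hw1
  rw [hd, hL₁]
  have hw1' : w - 1 ≠ 0 := sub_ne_zero.2 hw1
  field_simp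
  ring

/-- **The Dirichlet series of the twisted coefficients**: for `σ > 1`,
`∑ b(n) n^{-s} = δ_χ/(s − (1 − iτ)) + G(s)`. [cite: MontgomeryVaughan2007, §11.3 (11.22)] -/
theorem LSeries_twist_eq (χ : DirichletCharacter ℂ q) (τ : ℝ) {s : ℂ} (hs : 1 < s.re) :
    LSeries (twist χ τ) s = delta χ / (s - (1 - τ * I)) + G χ τ s := by
  have hw : 1 < (s + τ * I).re := by simp [hs]
  rw [LSeries_twist, ← DirichletZFR.neg_logDeriv_LFunction_eq χ hw]
  by_cases hχ : χ = 1
  · subst hχ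
    rw [neg_logDeriv_LFunction_one_eq hw, G_one, delta, if_pos rfl]
    rw [show s + τ * I - 1 = s - (1 - τ * I) by ring]
    ring
  · rw [G_of_ne_one hχ, delta, if_neg hχ, zero_div, zero_add]

/-! ### The hypotheses `TwistData` at a large scale -/

/-- `s ↦ −f'/f(s + c)` is differentiable at `s` when `f` is entire and `f(s + c) ≠ 0`. [folklore] -/
theorem differentiableAt_neg_logDeriv_shift {f : ℂ → ℂ} (hf : Differentiable ℂ f) (c : ℂ) {s : ℂ}
    (hs : f (s + c) ≠ 0) :
    DifferentiableAt ℂ (fun z ↦ -(deriv f (z + c) / f (z + c))) s := by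
  have hsh : DifferentiableAt ℂ (fun z : ℂ ↦ z + c) s := differentiableAt_id.add_const c
  have h1 : DifferentiableAt ℂ (fun z ↦ deriv f (z + c)) s :=
    ((hf.analyticAt (s + c)).deriv.differentiableAt).comp (f := fun z : ℂ ↦ z + c) s hsh
  have h2 : DifferentiableAt ℂ (fun z ↦ f (z + c)) s := (hf (s + c)).comp (f := fun z : ℂ ↦ z + c) s hsh
  exact (h1.div h2 hs).neg

/-- **`TwistData` at scale `X`, from any Vinogradov–Korobov region** `HasVKZeroFreeRegion c T₀` (`c > 0`;
explicit or not).  For `A > 0`, `2/3 < η ≤ 1` there is `C ≥ 0`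
such that for all large `X`, all `q ≤ (log X)^A`, all `χ` mod `q`, all `|τ| ≤ X` and `1 ≤ T ≤ X`:
`TwistData (twist χ τ) (G χ τ) δ_χ (1 − iτ) (1 − (log X)^{-η}/2) T (C (log X)³)` — the rectangle
`[1 − (log X)^{-η}/2, 2] × [−T, T]` shifted by `iτ` lies in `|Im| ≤ 2X`, where
`VKDirichlet.exists_norm_logDeriv_LFunction_le_of_vk` / `…LFunctionTrivChar₁_le_of_vk` give non-vanishing
and the bound. [cite: Khale2024, (1.4)] [cite: MontgomeryVaughan2007, Lemma 11.1] -/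
theorem exists_twistData_of_vk {cVK TVK : ℝ} (hcVK : 0 < cVK) (hVK : HasVKZeroFreeRegion cVK TVK)
    {A η : ℝ} (hA : 0 < A) (hη : 2 / 3 < η) (hη1 : η ≤ 1) :
    ∃ C : ℝ, 0 ≤ C ∧ ∀ᶠ X : ℝ in atTop, ∀ (q : ℕ) [NeZero q], (q : ℝ) ≤ Real.log X ^ A →
      ∀ (χ : DirichletCharacter ℂ q) (τ : ℝ), |τ| ≤ X → ∀ T : ℝ, 1 ≤ T → T ≤ X →
        TwistedRieszMean.TwistData (twist χ τ) (G χ τ) (delta χ) (1 - τ * I)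
          (1 - Real.log X ^ (-η) / 2) T (C * Real.log X ^ 3) := by
  obtain ⟨C₁, hC₁, h₁⟩ := VKDirichlet.exists_norm_logDeriv_LFunction_le_of_vk hcVK hVK hA hη hη1
  obtain ⟨C₂, hC₂, h₂⟩ := VKDirichlet.exists_norm_logDeriv_LFunctionTrivChar₁_le_of_vk hcVK hVK hA hη hη1
  have hη0 : 0 < η := by linarith
  refine ⟨C₁ + C₂, by positivity, ?_⟩
  filter_upwards [h₁, h₂, VKDirichlet.eventually_rpow_neg_lt hη0 one_pos,
    Real.tendsto_log_atTop.eventually_ge_atTop (1 : ℝ)] with X h₁X h₂X hsmall hL1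
  intro q _ hqA χ τ hτ T hT1 hTX
  set ℓ : ℝ := Real.log X with hℓ
  have hℓ0 : 0 ≤ ℓ := by linarith
  have hδpos : 0 < ℓ ^ (-η) := Real.rpow_pos_of_pos (by linarith) _
  -- points of the shifted rectangle
  have hrect : ∀ s ∈ Icc (1 - ℓ ^ (-η) / 2) 2 ×ℂ Icc (-T) T,
      |(s + τ * I).im| ≤ 2 * X ∧ 1 - ℓ ^ (-η) / 2 ≤ (s + τ * I).re ∧ (s + τ * I).re ≤ 2 := by
    intro s hs
    obtain ⟨⟨hre1, hre2⟩, him1, him2⟩ := hs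
    refine ⟨?_, by simpa using hre1, by simpa using hre2⟩
    have him : (s + τ * I).im = s.im + τ := by simp
    rw [him]
    have h1 : |s.im| ≤ T := abs_le.2 ⟨him1, him2⟩
    calc |s.im + τ| ≤ |s.im| + |τ| := abs_add_le _ _
      _ ≤ T + X := add_le_add h1 hτ
      _ ≤ 2 * X := by linarith
  have hB : C₁ * ℓ ^ 3 ≤ (C₁ + C₂) * ℓ ^ 3 ∧ C₂ * ℓ ^ 3 ≤ (C₁ + C₂) * ℓ ^ 3 := by
    constructor <;> nlinarith [pow_nonneg hℓ0 3]
  by_cases hχ : χ = 1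
  · subst hχ
    refine ⟨norm_twist_le 1 τ, norm_delta_le 1, by simp, by linarith, by linarith, hT1,
      by positivity, fun s hs ↦ LSeries_twist_eq 1 τ hs, ?_, ?_⟩
    · intro s hs
      obtain ⟨him, hre1, hre2⟩ := hrect s hs
      obtain ⟨hne, -⟩ := h₂X q hqA (s + τ * I) him hre1 hre2
      rw [G_one]
      exact (differentiableAt_neg_logDeriv_shift
        (DirichletCharacter.differentiable_LFunctionTrivChar₁ q) (τ * I) hne).differentiableWithinAt
    · intro s hs
      obtain ⟨him, hre1, hre2⟩ := hrect s hs
      obtain ⟨-, hle⟩ := h₂X q hqA (s + τ * I) him hre1 hre2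
      rw [G_one]
      simp only [norm_neg]
      exact hle.trans hB.2
  · refine ⟨norm_twist_le χ τ, norm_delta_le χ, by simp, by linarith, by linarith, hT1,
      by positivity, fun s hs ↦ LSeries_twist_eq χ τ hs, ?_, ?_⟩
    · intro s hs
      obtain ⟨him, hre1, hre2⟩ := hrect s hs
      obtain ⟨hne, -⟩ := h₁X q hqA χ hχ (s + τ * I) him hre1 hre2
      rw [G_of_ne_one hχ]
      exact (differentiableAt_neg_logDeriv_shift (DirichletCharacter.differentiable_LFunction hχ)
        (τ * I) hne).differentiableWithinAt
    · intro s hs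
      obtain ⟨him, hre1, hre2⟩ := hrect s hs
      obtain ⟨-, hle⟩ := h₁X q hqA χ hχ (s + τ * I) him hre1 hre2
      rw [G_of_ne_one hχ]
      simp only [norm_neg]
      exact hle.trans hB.1

/-- **`TwistData` at scale `X`** (Khale's form of `exists_twistData_of_vk`).  Assume Khale's theorem.  For
`A > 0`, `2/3 < η ≤ 1` there is `C ≥ 0` such that for all large `X`, all `q ≤ (log X)^A`, all `χ` mod `q`,
all `|τ| ≤ X` and `1 ≤ T ≤ X`: `TwistData (twist χ τ) (G χ τ) δ_χ (1 − iτ) (1 − (log X)^{-η}/2) T (C (log X)³)`.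
[cite: Khale2024, Theorem 1.1] [cite: MontgomeryVaughan2007, Lemma 11.1] -/
theorem exists_twistData (hK : Khale2024_zeroFreeRegion) {A η : ℝ} (hA : 0 < A) (hη : 2 / 3 < η)
    (hη1 : η ≤ 1) :
    ∃ C : ℝ, 0 ≤ C ∧ ∀ᶠ X : ℝ in atTop, ∀ (q : ℕ) [NeZero q], (q : ℝ) ≤ Real.log X ^ A →
      ∀ (χ : DirichletCharacter ℂ q) (τ : ℝ), |τ| ≤ X → ∀ T : ℝ, 1 ≤ T → T ≤ X →
        TwistedRieszMean.TwistData (twist χ τ) (G χ τ) (delta χ) (1 - τ * I)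
          (1 - Real.log X ^ (-η) / 2) T (C * Real.log X ^ 3) :=
  exists_twistData_of_vk (by norm_num) (hasVKZeroFreeRegion_of_khale hK) hA hη hη1

/-! ### The twisted prime number theorem at scale `X` -/

/-- `ψ(y) − ψ(x) ≤ (y − x) + 3 C₁ x e^{−c₁√log x}` for `2 ≤ x ≤ y ≤ 2x`, from
`|ψ(u) − u| ≤ C₁ u e^{−c₁ √log u}` (de la Vallée-Poussin, `ChebyshevPsiDeLaValleePoussin_holds`).
[cite: MontgomeryVaughan2007, Theorem 6.9] -/
theorem psi_sub_psi_le {c₁ C₁ : ℝ} (hc₁ : 0 < c₁) (hC₁ : 0 ≤ C₁)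
    (hψ : ∀ u : ℝ, 2 ≤ u → |Chebyshev.psi u - u| ≤ C₁ * u / Real.exp (c₁ * Real.sqrt (Real.log u)))
    {x y : ℝ} (hx : 2 ≤ x) (hxy : x ≤ y) (hy : y ≤ 2 * x) :
    Chebyshev.psi y - Chebyshev.psi x ≤
      (y - x) + 3 * C₁ * x / Real.exp (c₁ * Real.sqrt (Real.log x)) := by
  have hx0 : 0 < x := by linarith
  have hy0 : 0 < y := by linarith
  have h1 := hψ x hx
  have h2 := hψ y (by linarith)
  have hex : Real.exp (c₁ * Real.sqrt (Real.log x)) ≤ Real.exp (c₁ * Real.sqrt (Real.log y)) := by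
    apply Real.exp_le_exp.2
    exact mul_le_mul_of_nonneg_left (Real.sqrt_le_sqrt (Real.log_le_log hx0 hxy)) hc₁.le
  have hEx : 0 < Real.exp (c₁ * Real.sqrt (Real.log x)) := Real.exp_pos _
  set e : ℝ := Real.exp (c₁ * Real.sqrt (Real.log x)) with he
  have h3 : C₁ * y / Real.exp (c₁ * Real.sqrt (Real.log y)) ≤ 2 * C₁ * x / e := by
    calc C₁ * y / Real.exp (c₁ * Real.sqrt (Real.log y)) ≤ C₁ * y / e :=
          div_le_div_of_nonneg_left (by positivity) hEx hex
      _ ≤ 2 * C₁ * x / e := by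
          rw [div_le_div_iff_of_pos_right hEx]; nlinarith
  generalize Chebyshev.psi y = ψy at h2 ⊢
  generalize Chebyshev.psi x = ψx at h1 ⊢
  have h4 := (abs_le.1 h1).1
  have h5 := (abs_le.1 h2).2
  have h6 : C₁ * x / e + 2 * C₁ * x / e = 3 * C₁ * x / e := by ring
  linarith

/-- Elementary: `D₀ = 2 log(2X) + K₀ + 1 + C ℓ³ ≤ (5 + K₀ + C) ℓ³` for `ℓ = log X ≥ 1`. [folklore] -/
theorem D0_le {X K₀ C : ℝ} (hX : 0 < X) (hℓ1 : 1 ≤ Real.log X) (hK₀ : 0 ≤ K₀) :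
    2 * Real.log (2 * X) + K₀ + 1 + C * Real.log X ^ (3 : ℕ) ≤ (5 + K₀ + C) * Real.log X ^ (3 : ℕ) := by
  set ℓ := Real.log X with hℓ
  have h1 : Real.log (2 * X) = Real.log 2 + ℓ := by rw [hℓ, Real.log_mul (by norm_num) hX.ne']
  have h2 : Real.log 2 ≤ 1 := by
    have := Real.log_le_sub_one_of_pos (show (0 : ℝ) < 2 by norm_num); linarith
  have hℓ13 : 1 ≤ ℓ ^ (3 : ℕ) := one_le_pow₀ hℓ1
  have h3 : ℓ ≤ ℓ ^ (3 : ℕ) := by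
    calc ℓ = ℓ ^ 1 := (pow_one ℓ).symm
      _ ≤ ℓ ^ 3 := pow_le_pow_right₀ hℓ1 (by norm_num)
  have h4 : K₀ ≤ K₀ * ℓ ^ (3 : ℕ) := le_mul_of_one_le_right hK₀ hℓ13
  rw [h1]
  nlinarith

set_option maxHeartbeats 1600000 in
/-- **The twisted prime number theorem at scale `X` (Vinogradov–Korobov range), from any
Vinogradov–Korobov region** `HasVKZeroFreeRegion c T₀`, `c > 0`.  For `A > 0`, `θ > 2/3`, `K ≥ 0`: for all large `X`, all `q ≤ (log X)^A`, all Dirichlet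
characters `χ` mod `q`, all real `τ` with `|τ| ≤ X` and all `x` with `exp((log X)^θ)/2 ≤ x ≤ X`,
`‖∑_{n ≤ x} χ(n)Λ(n)n^{-iτ} − δ_χ x^{1−iτ}/(1 − iτ)‖ ≤ (log X)^{-K} x`
(`δ_χ = 𝟙_{χ = χ₀}`; the constant implicit in "large `X`" depends on `A, θ, K` and, through Siegel's
theorem, ineffectively on `A`).  This is the twisted form of MR 2015 Lemma 2 / Lichtman 2020 Lemma 4.5
before partial summation.  Proof: `TwistData` at scale `X` (`exists_twistData_of_vk`, `2/3 < η < θ`) with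
`T = 160 D₀ (log X)^{2K} ≤ X`, the contour estimate and the differencing step of `TwistedRieszMean`
with `y = x(1 + ε/4)`, `ε = (log X)^{-K}`, the saving `x^{−(log X)^{-η}/2} ≤ e^{1/2 − (log X)^{θ−η}/2}`
and de la Vallée-Poussin's `ψ(y) − ψ(x) ≤ (y − x) + 3C₁x e^{−c₁√log x}`.
[cite: Lichtman2020, Lemma 4.5] [cite: Khale2024, Theorem 1.1] -/
theorem twisted_sum_estimate_of_vk {cVK TVK : ℝ} (hcVK : 0 < cVK) (hVK : HasVKZeroFreeRegion cVK TVK)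
    {A θ K : ℝ} (hA : 0 < A) (hθ : 2 / 3 < θ) (hK0 : 0 ≤ K) :
    ∀ᶠ X : ℝ in atTop, ∀ (q : ℕ) [NeZero q], (q : ℝ) ≤ Real.log X ^ A →
      ∀ (χ : DirichletCharacter ℂ q) (τ : ℝ), |τ| ≤ X → ∀ x : ℝ,
        Real.exp (Real.log X ^ θ) / 2 ≤ x → x ≤ X →
          ‖∑ n ∈ Finset.Ioc 0 ⌊x⌋₊, twist χ τ n -
              delta χ * (x : ℂ) ^ (1 - τ * I) / (1 - τ * I)‖ ≤ Real.log X ^ (-K) * x := by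
  -- parameters
  set η : ℝ := min ((2 / 3 + θ) / 2) 1 with hηdef
  have hη : 2 / 3 < η := lt_min (by linarith) (by norm_num)
  have hη1 : η ≤ 1 := min_le_right _ _
  have hηθ : η < θ := lt_of_le_of_lt (min_le_left _ _) (by linarith)
  have hη0 : 0 < η := by linarith
  have hθ0 : 0 < θ := by linarith
  have hθη : 0 < θ - η := by linarith
  obtain ⟨C, hC, hTD⟩ := exists_twistData_of_vk hcVK hVK hA hη hη1
  obtain ⟨K₀, hK₀, hKL⟩ := TwistedRieszMean.exists_norm_LSeries_le
  obtain ⟨c₁, hc₁, C₁, hψ⟩ := ChebyshevPsiDeLaValleePoussin_holds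
  set C₁' : ℝ := max C₁ 0 with hC₁'
  have hC₁'0 : 0 ≤ C₁' := le_max_right _ _
  have hψ' : ∀ u : ℝ, 2 ≤ u →
      |Chebyshev.psi u - u| ≤ C₁' * u / Real.exp (c₁ * Real.sqrt (Real.log u)) := by
    intro u hu
    refine (hψ u hu).trans ?_
    rw [mul_div_assoc, mul_div_assoc]
    exact mul_le_mul_of_nonneg_right (le_max_left _ _) (by positivity)
  set D : ℝ := 5 + K₀ + C with hDdef
  have hsqrt2 : 0 < c₁ / Real.sqrt 2 := by positivity
  filter_upwards [hTD, Real.tendsto_log_atTop.eventually_ge_atTop (1 : ℝ),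
    ((tendsto_rpow_atTop hθ0).comp Real.tendsto_log_atTop).eventually_ge_atTop (4 : ℝ),
    eventually_mul_log_rpow_le_exp (160 * D) (3 + 2 * K) one_pos one_pos,
    eventually_mul_log_rpow_le_exp (320 * C * Real.exp (1 / 2)) (3 + 2 * K)
      (show (0 : ℝ) < 1 / 2 by norm_num) hθη,
    eventually_mul_log_rpow_le_exp 16 K one_pos hθ0,
    eventually_mul_log_rpow_le_exp (24 * C₁') K hsqrt2 (half_pos hθ0),
    eventually_gt_atTop (0 : ℝ)] with X hTDX hℓ1 hℓθ hE3 hE4 hE5 hE6 hX0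
  intro q _ hqA χ τ hτ x hxlo hxX
  -- notation
  set ℓ : ℝ := Real.log X with hℓdef
  have hℓ0 : 0 < ℓ := by linarith
  have hℓθ' : (4 : ℝ) ≤ ℓ ^ θ := by simpa using hℓθ
  have hexpℓ : Real.exp ℓ = X := by rw [hℓdef, Real.exp_log hX0]
  set ε : ℝ := ℓ ^ (-K) with hεdef
  have hε0 : 0 < ε := Real.rpow_pos_of_pos hℓ0 _
  have hε1 : ε ≤ 1 := Real.rpow_le_one_of_one_le_of_nonpos hℓ1 (by linarith)
  have hℓKε : ℓ ^ K * ε = 1 := by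
    rw [hεdef, ← Real.rpow_add hℓ0, show K + -K = 0 by ring, Real.rpow_zero]
  set E2 : ℝ := ℓ ^ (2 * K) with hE2def
  have hE2pos : 0 < E2 := Real.rpow_pos_of_pos hℓ0 _
  have hE21 : 1 ≤ E2 := Real.one_le_rpow hℓ1 (by positivity)
  have hεE : ε ^ 2 * E2 = 1 := by
    rw [hεdef, hE2def, ← Real.rpow_natCast, ← Real.rpow_mul hℓ0.le, ← Real.rpow_add hℓ0,
      show -K * ((2 : ℕ) : ℝ) + 2 * K = 0 by push_cast; ring, Real.rpow_zero]
  have hε2 : ε ^ 2 = 1 / E2 := by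
    rw [eq_div_iff hE2pos.ne']; exact hεE
  set B : ℝ := C * ℓ ^ 3 with hBdef
  have hB0 : 0 ≤ B := by positivity
  have hlog2X : 0 ≤ Real.log (2 * X) := Real.log_nonneg (by
    have h1 : Real.exp 1 ≤ X := by rw [← hexpℓ]; exact Real.exp_le_exp.2 hℓ1
    have h2 := Real.add_one_le_exp (1 : ℝ); linarith)
  set D₀ : ℝ := 2 * Real.log (2 * X) + K₀ + 1 + B with hD₀def
  have hD₀1 : 1 ≤ D₀ := by rw [hD₀def]; linarith
  have hD₀B : B ≤ D₀ := by rw [hD₀def]; linarith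
  set T : ℝ := 160 * D₀ * E2 with hTdef
  have hDE : 1 ≤ D₀ * E2 := by
    have := mul_le_mul hD₀1 hE21 zero_le_one (by linarith); simpa using this
  have hT1 : 1 ≤ T := by rw [hTdef]; linarith
  have hT2 : 2 ≤ T := by rw [hTdef]; linarith
  have hT0 : 0 < T := by linarith
  -- `T ≤ X`
  have hℓ3 : ℓ ^ (3 : ℕ) * E2 = ℓ ^ (3 + 2 * K) := by
    rw [← Real.rpow_natCast, hE2def, ← Real.rpow_add hℓ0]; norm_num
  have hD₀le : D₀ ≤ D * ℓ ^ (3 : ℕ) := D0_le hX0 hℓ1 hK₀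
  have hTX : T ≤ X := by
    calc T = 160 * D₀ * E2 := rfl
      _ ≤ 160 * (D * ℓ ^ (3 : ℕ)) * E2 := by gcongr
      _ = 160 * D * ℓ ^ (3 + 2 * K) := by rw [← hℓ3]; ring
      _ ≤ Real.exp (1 * ℓ ^ (1 : ℝ)) := hE3
      _ = X := by rw [one_mul, Real.rpow_one, hexpℓ]
  -- the data
  have hD := hTDX q hqA χ τ hτ T hT1 hTX
  -- `x` and `y`
  have hlog2 : Real.log 2 ≤ 1 := by
    have := Real.log_le_sub_one_of_pos (show (0 : ℝ) < 2 by norm_num); linarith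
  have hx2e : Real.exp 2 ≤ x := by
    refine le_trans ?_ hxlo
    rw [le_div_iff₀ (by norm_num : (0 : ℝ) < 2)]
    calc Real.exp 2 * 2 ≤ Real.exp 2 * Real.exp 2 := by
          gcongr; have := Real.add_one_le_exp (2 : ℝ); linarith
      _ = Real.exp 4 := by rw [← Real.exp_add]; norm_num
      _ ≤ Real.exp (ℓ ^ θ) := Real.exp_le_exp.2 hℓθ'
  have hx2 : 2 ≤ x := le_trans (by have := Real.add_one_le_exp (2 : ℝ); linarith) hx2e
  have hx1 : 1 ≤ x := by linarith
  have hx0 : 0 < x := by linarith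
  have hlogx : ℓ ^ θ - Real.log 2 ≤ Real.log x := by
    have h1 : Real.log (Real.exp (ℓ ^ θ) / 2) = ℓ ^ θ - Real.log 2 := by
      rw [Real.log_div (Real.exp_pos _).ne' (by norm_num), Real.log_exp]
    rw [← h1]
    exact Real.log_le_log (by positivity) hxlo
  have hlogx' : ℓ ^ θ / 2 ≤ Real.log x := by linarith
  set Δ : ℝ := ε / 4 with hΔdef
  have hΔ0 : 0 < Δ := by positivity
  have hΔ1 : Δ ≤ 1 := by linarith
  set y : ℝ := x * (1 + Δ) with hydef
  have hyx : y - x = Δ * x := by rw [hydef]; ring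
  have hΔx : 0 < Δ * x := mul_pos hΔ0 hx0
  have hxy : x < y := by linarith
  have hΔx1 : Δ * x ≤ 1 * x := mul_le_mul_of_nonneg_right hΔ1 hx0.le
  have hy2x : y ≤ 2 * x := by linarith
  have hy2X : y ≤ 2 * X := by linarith
  have hye : Real.exp 2 ≤ y := by linarith
  have hy0 : 0 < y := by linarith
  -- the three analytic estimates
  have hIx := hD.norm_rieszMean_sub_le hK₀ hKL hx2e
  have hIy := hD.norm_rieszMean_sub_le hK₀ hKL hye
  have hmain := hD.norm_sum_sub_le hx1 hxy
  -- the saving `P = x^{σ₁ - 1}`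
  set P : ℝ := x ^ (1 - ℓ ^ (-η) / 2 - 1) with hPdef
  have hP0 : 0 < P := Real.rpow_pos_of_pos hx0 _
  have hδ1 : ℓ ^ (-η) ≤ 1 := Real.rpow_le_one_of_one_le_of_nonpos hℓ1 (by linarith)
  have hδ0 : 0 < ℓ ^ (-η) := Real.rpow_pos_of_pos hℓ0 _
  have hPle : P ≤ Real.exp (-(ℓ ^ (θ - η) / 2) + 1 / 2) := by
    rw [hPdef, Real.rpow_def_of_pos hx0]
    apply Real.exp_le_exp.2
    have h1 : Real.log x * (1 - ℓ ^ (-η) / 2 - 1) = -(ℓ ^ (-η) / 2 * Real.log x) := by ring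
    rw [h1]
    have h2 : ℓ ^ (-η) / 2 * (ℓ ^ θ - Real.log 2) ≤ ℓ ^ (-η) / 2 * Real.log x :=
      mul_le_mul_of_nonneg_left hlogx (by positivity)
    have h3 : ℓ ^ (-η) * ℓ ^ θ = ℓ ^ (θ - η) := by
      rw [← Real.rpow_add hℓ0]; ring_nf
    have h4 : ℓ ^ (-η) * Real.log 2 ≤ 1 := by
      calc ℓ ^ (-η) * Real.log 2 ≤ 1 * 1 :=
            mul_le_mul hδ1 hlog2 (Real.log_nonneg (by norm_num)) zero_le_one
        _ = 1 := one_mul _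
    have h5 : ℓ ^ (-η) / 2 * (ℓ ^ θ - Real.log 2) = ℓ ^ (θ - η) / 2 - ℓ ^ (-η) * Real.log 2 / 2 := by
      rw [← h3]; ring
    linarith
  -- (E4): `320 B P ≤ ε²`
  have hBP : 320 * B * P ≤ ε ^ 2 := by
    have h1 : 320 * B * P * E2 ≤ 1 := by
      calc 320 * B * P * E2 ≤ 320 * B * Real.exp (-(ℓ ^ (θ - η) / 2) + 1 / 2) * E2 := by
            gcongr
        _ = 320 * C * Real.exp (1 / 2) * ℓ ^ (3 + 2 * K) * Real.exp (-(ℓ ^ (θ - η) / 2)) := by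
            rw [Real.exp_add, hBdef, ← hℓ3]; ring
        _ ≤ Real.exp (1 / 2 * ℓ ^ (θ - η)) * Real.exp (-(ℓ ^ (θ - η) / 2)) :=
            mul_le_mul_of_nonneg_right hE4 (Real.exp_pos _).le
        _ = 1 := by rw [← Real.exp_add, show 1 / 2 * ℓ ^ (θ - η) + -(ℓ ^ (θ - η) / 2) = 0 by ring,
            Real.exp_zero]
    rw [hε2, le_div_iff₀ hE2pos]; exact h1
  -- (E5): `1 ≤ ε x / 8`
  have hone : 1 ≤ ε * x / 8 := by
    have h1 : 16 * ℓ ^ K ≤ Real.exp (ℓ ^ θ) := by simpa using hE5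
    have h3 : Real.exp (ℓ ^ θ) ≤ 2 * x := by linarith
    have h4 := mul_le_mul_of_nonneg_right (h1.trans h3) hε0.le
    have h5 : 16 * ℓ ^ K * ε = 16 := by rw [mul_assoc, hℓKε, mul_one]
    rw [h5] at h4
    linarith
  -- (E6): `3 C₁' x / exp(c₁ √log x) ≤ ε x / 8`
  set eψ : ℝ := Real.exp (c₁ * Real.sqrt (Real.log x)) with heψ
  have heψ0 : 0 < eψ := Real.exp_pos _
  have hψerr : 3 * C₁' * x / eψ ≤ ε * x / 8 := by
    have h1 : 24 * C₁' * ℓ ^ K ≤ Real.exp (c₁ / Real.sqrt 2 * ℓ ^ (θ / 2)) := hE6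
    have h2 : c₁ / Real.sqrt 2 * ℓ ^ (θ / 2) ≤ c₁ * Real.sqrt (Real.log x) := by
      have h3 : Real.sqrt (ℓ ^ θ / 2) ≤ Real.sqrt (Real.log x) := Real.sqrt_le_sqrt hlogx'
      have h4 : Real.sqrt (ℓ ^ θ / 2) = ℓ ^ (θ / 2) / Real.sqrt 2 := by
        rw [Real.sqrt_div (Real.rpow_nonneg hℓ0.le _), Real.sqrt_eq_rpow, ← Real.rpow_mul hℓ0.le]
        ring_nf
      rw [h4] at h3
      calc c₁ / Real.sqrt 2 * ℓ ^ (θ / 2) = c₁ * (ℓ ^ (θ / 2) / Real.sqrt 2) := by ring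
        _ ≤ c₁ * Real.sqrt (Real.log x) := mul_le_mul_of_nonneg_left h3 hc₁.le
    have h5 : 24 * C₁' * ℓ ^ K ≤ eψ := h1.trans (Real.exp_le_exp.2 h2)
    rw [div_le_iff₀ heψ0]
    have h7 := mul_le_mul_of_nonneg_left h5 (show 0 ≤ ε * x / 8 by positivity)
    have h8 : ε * x / 8 * (24 * C₁' * ℓ ^ K) = 3 * C₁' * x * (ℓ ^ K * ε) := by ring
    rw [h8, hℓKε, mul_one] at h7
    exact h7
  -- the bound `Q` for the brackets
  set Q : ℝ := (2 * Real.log (2 * X) + K₀) / T + 2 * B * P + 2 * B / T ^ 2 with hQdef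
  have hTε : T * (ε ^ 2 / 160) = D₀ := by
    rw [hTdef, show 160 * D₀ * E2 * (ε ^ 2 / 160) = D₀ * (ε ^ 2 * E2) by ring, hεE, mul_one]
  have hQ1 : (2 * Real.log (2 * X) + K₀) / T ≤ ε ^ 2 / 160 := by
    rw [div_le_iff₀ hT0, show ε ^ 2 / 160 * T = T * (ε ^ 2 / 160) by ring, hTε, hD₀def]
    linarith
  have hQ2 : 2 * B / T ^ 2 ≤ ε ^ 2 / 160 := by
    have h1 : 2 * B ≤ T * (ε ^ 2 / 160) * 2 := by rw [hTε]; linarith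
    rw [div_le_iff₀ (by positivity)]
    calc 2 * B ≤ T * (ε ^ 2 / 160) * 2 := h1
      _ ≤ T * (ε ^ 2 / 160) * T := by gcongr
      _ = ε ^ 2 / 160 * T ^ 2 := by ring
  have hQ3 : 2 * B * P ≤ ε ^ 2 / 160 := by linarith
  have hQ : Q ≤ 3 * ε ^ 2 / 160 := by rw [hQdef]; linarith
  have hQ0 : 0 ≤ Q := by rw [hQdef]; positivity
  -- `‖Ix‖ ≤ x² Q`, `‖Iy‖ ≤ 4 x² Q`
  have hlogxX : Real.log x ≤ Real.log (2 * X) := Real.log_le_log hx0 (by linarith)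
  have hlogyX : Real.log y ≤ Real.log (2 * X) := Real.log_le_log hy0 hy2X
  have hPy : y ^ (1 - ℓ ^ (-η) / 2 - 1) ≤ P :=
    Real.rpow_le_rpow_of_nonpos hx0 hxy.le (by linarith)
  set Ix : ℝ := ‖TwistedRieszMean.rieszMeanC (twist χ τ) x -
    delta χ * TwistedRieszMean.mainTerm (1 - τ * I) x‖ with hIxdef
  set Iy : ℝ := ‖TwistedRieszMean.rieszMeanC (twist χ τ) y -
    delta χ * TwistedRieszMean.mainTerm (1 - τ * I) y‖ with hIydef
  have hIx' : Ix ≤ x ^ 2 * Q := by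
    refine hIx.trans (mul_le_mul_of_nonneg_left ?_ (by positivity))
    rw [hQdef]
    gcongr
  have hIy' : Iy ≤ 4 * x ^ 2 * Q := by
    refine hIy.trans ?_
    have h1 : y ^ 2 ≤ 4 * x ^ 2 := by
      have := pow_le_pow_left₀ hy0.le hy2x 2; nlinarith
    have h2 : (2 * Real.log y + K₀) / T + 2 * B * y ^ (1 - ℓ ^ (-η) / 2 - 1) + 2 * B / T ^ 2 ≤ Q := by
      rw [hQdef]; gcongr
    calc y ^ 2 * ((2 * Real.log y + K₀) / T + 2 * B * y ^ (1 - ℓ ^ (-η) / 2 - 1) + 2 * B / T ^ 2)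
        ≤ y ^ 2 * Q := mul_le_mul_of_nonneg_left h2 (by positivity)
      _ ≤ 4 * x ^ 2 * Q := mul_le_mul_of_nonneg_right h1 hQ0
  -- the first term of `hmain`
  have hfirst : (Iy + Ix) / (y - x) ≤ 3 * ε * x / 8 := by
    rw [hyx, div_le_iff₀ hΔx]
    calc Iy + Ix ≤ 4 * x ^ 2 * Q + x ^ 2 * Q := add_le_add hIy' hIx'
      _ = 5 * x ^ 2 * Q := by ring
      _ ≤ 5 * x ^ 2 * (3 * ε ^ 2 / 160) := by gcongr
      _ = 3 * ε * x / 8 * (ε / 4 * x) := by ring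
  -- Chebyshev
  have hψb := psi_sub_psi_le hc₁ hC₁'0 hψ' hx2 hxy.le hy2x
  rw [← heψ] at hψb
  -- assemble
  refine hmain.trans ?_
  generalize Chebyshev.psi y = ψy at hψb ⊢
  generalize Chebyshev.psi x = ψx at hψb ⊢
  have hfin : 3 * ε * x / 8 + Δ * x / 2 + ε * x / 8 + (Δ * x + ε * x / 8) = ε * x := by
    rw [hΔdef]; ring
  linarith [hfirst, hone, hψerr, hψb, hfin, hyx]


/-- **The twisted prime number theorem at scale `X`** (Khale's form of `twisted_sum_estimate_of_vk`).  Assume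
Khale's Theorem 1.1.  For `A > 0`, `θ > 2/3`, `K ≥ 0`: for all large `X`, all `q ≤ (log X)^A`, all Dirichlet
characters `χ` mod `q`, all real `τ` with `|τ| ≤ X` and all `x` with `exp((log X)^θ)/2 ≤ x ≤ X`,
`‖∑_{n ≤ x} χ(n)Λ(n)n^{-iτ} − δ_χ x^{1−iτ}/(1 − iτ)‖ ≤ (log X)^{-K} x`.
[cite: Lichtman2020, Lemma 4.5] [cite: Khale2024, Theorem 1.1] -/
theorem twisted_sum_estimate (hK : Khale2024_zeroFreeRegion) {A θ K : ℝ} (hA : 0 < A)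
    (hθ : 2 / 3 < θ) (hK0 : 0 ≤ K) :
    ∀ᶠ X : ℝ in atTop, ∀ (q : ℕ) [NeZero q], (q : ℝ) ≤ Real.log X ^ A →
      ∀ (χ : DirichletCharacter ℂ q) (τ : ℝ), |τ| ≤ X → ∀ x : ℝ,
        Real.exp (Real.log X ^ θ) / 2 ≤ x → x ≤ X →
          ‖∑ n ∈ Finset.Ioc 0 ⌊x⌋₊, twist χ τ n -
              delta χ * (x : ℂ) ^ (1 - τ * I) / (1 - τ * I)‖ ≤ Real.log X ^ (-K) * x :=
  twisted_sum_estimate_of_vk (by norm_num) (hasVKZeroFreeRegion_of_khale hK) hA hθ hK0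

end TwistedVonMangoldt

end Literature.NumberTheory.LFunctions
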